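import Summits.CriticalPhenomena.PercolationContinuityZ3.Theorems.PercNearOneGluingNoHeavyQuantLightSliceLowCrossBelowCrossed
import Summits.CriticalPhenomena.PercolationContinuityZ3.Theorems.PercNearOneGluingNoHeavyQuantOneMidTerms
import Summits.CriticalPhenomena.PercolationContinuityZ3.Theorems.PercNearOneGluingNoHeavyQuantLightSliceLowCrossSplit
import HarnessLib

/-!
# QUANT lane R8, T-DEC: **`LightSliceLowCrossBelow` IS A THEOREM** — the Type I class (`h₂′ = h₂`, one useful mid) closed in the kernel,
# hence `LightSliceLowCross`, and `LightSliceCore ⟸ LightSliceWide` alone (census-2 g60)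

builds on p205010 (kernel theorem, internal audit signed; external expert review pending)

Support file (`--supports stmt-CriticalPhenomena-4575`), QUANT lane seat prim-quant-census-2 (gen 60), rung R8 of `…/quant/LADDER.md`.
Memo `run/shared/lean/prim/quant/prim-quant-census-2-g60/TWO-MID-G60.md`.  Theorems only, standard axioms, no sorries, no definitions.

* `LawDec.lightSlice_decAtT_typeI_of_oneMid` — THE ONE-MID KNAPSACK FORM of the Type I class: the light slice (eight-term law
  `lightSlice_eq_terms` with `h′ = h`) with the lows `p+l, p+l′, m+l, m+l′`, the single mid `p+h ≤ j` and the giant `m+h` is `DECAtT` as soon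
  as the reduced price inequality holds — via `decAtT_of_oneMid_terms` (`…QuantOneMidTerms`).
* **`LawDec.lightSlice_decAtT_lowCross_below_typeI`** — floor `0 < x < 1`; side 1's light credit pair `{p, m}` at `T₁` (`2p < T₁ < p+m`,
  `m ≤ j`, `m ≤ M₁`, usage `< u`); side 2's Type I admissible atom `(l, h; l′, h)` at `T₂` (`AtomData`, `l < l′`); top giant `j+1 ≤ m+h`,
  LOW CROSS `2(m+l′) < T₁+T₂`, the mid below the giant line `p + h ≤ j`.  Then the light slice is `DECAtT x (T₁+T₂) j (M₁+M₂)`.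
  PROOF: the same rates as the crossed class (`…LightSliceLowCrossBelowCrossed`) with `h′ := h`, where now `2 − ρc = ε(2 − ρe)`, and the
  same cell inequality `TwoMidCell.main` with both prices equal (census-1's pattern LLG is this class).
* **`LawDec.lightSliceLowCrossBelow_holds : LightSliceLowCrossBelow`** (Type I ∪ crossed Type II), hence
  **`lightSliceLowCross_holds : LightSliceLowCross`**, `lightSliceCore_of_wide : LightSliceWide → LightSliceCore`,
  `convClosedT_of_wide`, and `Quant.farTreeRow_of_wide : LightSliceWide → GatedConvEmptyFree → FarTreeRow`,
  `Quant.farTreeRow_of_wide_gateMove : LightSliceWide → GateMove → FarTreeRow`.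
STATE of the R8 law level after this file: **`LightSliceCore ⟸ LightSliceWide`** and **`FarTreeRow ⟸ LightSliceWide ∧ (GatedConvEmptyFree ∨
GateMove)`**; `LightSliceWide` is proved at the floors `1 ≤ x³+x²+3x` by arm-2 (`lightSliceWide_of_sharpFloor`).
EXACT CENSUS: 86 791 Type I instances at M ≤ 8 (kit j163808), 0 light-slice failures; the cell LP has 0 failures on the relaxed region.

[this work].  The gluing rows served [cite: KozmaNitzan2024, Conjecture 3 (p. 15)]; product measure [cite: Grimmett1999, §1.3 p. 10].
-/

noncomputable section

namespace Summit.CriticalPhenomena.PercolationContinuityZ3.Theorems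

namespace Quant

open Finset

/-- the two-point law `{lo, hi; g}` (as in `…QuantLawDEC`) -/
local notation3 "TP[" lo ", " hi ", " g ", " h "]" =>
  (g : ℝ) * (if (h : ℕ) = (hi : ℕ) then (1 : ℝ) else 0) + (1 - (g : ℝ)) * (if (h : ℕ) = (lo : ℕ) then (1 : ℝ) else 0)

namespace LawDec

/-- `min 1 (if c then v else 1) = if c then min 1 v else 1` -/
theorem min_one_ite (c : Prop) [Decidable c] (v : ℝ) : min 1 (if c then v else 1) = (if c then min 1 v else 1) := by
  split_ifs
  · rfl
  · exact min_self 1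

/-- **ONE-MID KNAPSACK FORM OF THE TYPE I LOW-CROSS CLASS (`h′ = h`).**  Light pair `{p, m}` (`p < m`) with gate `γ ∈ [0,1]`, the Type I
atom `(l, h; l′, h)` (`l < l′ < h`) with rates `0 ≤ c₂ < u < c₁`; the single mid `p + h ≤ j`; the cross cell `m + l′` a conv-low compatible with
it (`2(m + l′) < T < (m + l′) + (p + h)`), the cell `m + l` compatible with it; the giant `m + h ≥ j + 1`; tops `m ≤ M₁`, `h ≤ M₂`.  If for all
prices `β ≥ 0` the reduced price inequality holds (in the two-price form of `TwoMidCell.main` with both prices equal to `β`), the light slice is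
`DECAtT x T j (M₁+M₂)`.  [this work] -/
theorem lightSlice_decAtT_typeI_of_oneMid (x T T₂ γ : ℝ) (M₁ M₂ j p m l h l' : ℕ) (hx0 : 0 < x) (hx1 : x < 1)
    (hγ0 : 0 ≤ γ) (hγ1 : γ ≤ 1) (hc₂0 : 0 ≤ usage x T₂ j l' h) (hc₂u : usage x T₂ j l' h < x / (1 - x)) (huc₁ : x / (1 - x) < usage x T₂ j l h)
    (hpm : p < m) (hll' : l < l') (hl'h : l' < h) (hmM : m ≤ M₁) (hhM : h ≤ M₂)
    (hlow : 2 * ((m : ℝ) + l') < T) (hbelow : m + l' < p + h) (hPj : p + h ≤ j) (hMG : j + 1 ≤ m + h)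
    (hM2c : T < ((m : ℝ) + l') + ((p : ℝ) + h)) (hM1c : T < ((m : ℝ) + l) + ((p : ℝ) + h))
    (hdual : ∀ β : ℝ, 0 ≤ β →
      (1 - γ) * ((1 - x) / (usage x T₂ j l h - usage x T₂ j l' h) * (x / (1 - x) - usage x T₂ j l' h))
          * (if T < ((p : ℝ) + l) + ((p : ℝ) + h) then min 1 (usage x T j (p + l) (p + h) * β) else 1)
        + (1 - γ) * ((1 - x) / (usage x T₂ j l h - usage x T₂ j l' h) * (usage x T₂ j l h - x / (1 - x)))
          * (if T < ((p : ℝ) + l') + ((p : ℝ) + h) then min 1 (usage x T j (p + l') (p + h) * β) else 1)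
        + γ * ((1 - x) / (usage x T₂ j l h - usage x T₂ j l' h) * (x / (1 - x) - usage x T₂ j l' h))
          * min 1 (usage x T j (m + l) (p + h) * β)
        + γ * ((1 - x) / (usage x T₂ j l h - usage x T₂ j l' h) * (usage x T₂ j l h - x / (1 - x)))
          * min 1 (usage x T j (m + l') (p + h) * β)
      ≤ β * ((1 - γ) * ((1 - x) / (usage x T₂ j l h - usage x T₂ j l' h) * (usage x T₂ j l h - x / (1 - x)) * usage x T₂ j l' h))
        + β * ((1 - γ) * ((1 - x) / (usage x T₂ j l h - usage x T₂ j l' h) * (x / (1 - x) - usage x T₂ j l' h) * usage x T₂ j l h))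
        + ((1 - x) / x) *
          (γ * ((1 - x) / (usage x T₂ j l h - usage x T₂ j l' h) * (x / (1 - x) - usage x T₂ j l' h) * usage x T₂ j l h)
            + γ * ((1 - x) / (usage x T₂ j l h - usage x T₂ j l' h) * (usage x T₂ j l h - x / (1 - x)) * usage x T₂ j l' h))) :
    DECAtT x T j (M₁ + M₂) (lconv M₁ M₂ (fun b => TP[p, m, γ, b]) (atomLaw x T₂ j l h l' h)) := by
  have h1x : 0 < 1 - x := by linarith
  have hK : 0 ≤ (1 - x) / (usage x T₂ j l h - usage x T₂ j l' h) := div_nonneg h1x.le (by linarith)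
  have hmE : 0 ≤ (1 - x) / (usage x T₂ j l h - usage x T₂ j l' h) * (x / (1 - x) - usage x T₂ j l' h) := mul_nonneg hK (by linarith)
  have hmC : 0 ≤ (1 - x) / (usage x T₂ j l h - usage x T₂ j l' h) * (usage x T₂ j l h - x / (1 - x)) := mul_nonneg hK (by linarith)
  have hc₁0 : 0 ≤ usage x T₂ j l h := by have := div_pos hx0 h1x; linarith
  have hq1 : p + l ≤ j ∧ 2 * ((p : ℝ) + l) < T := ⟨by omega, by
    have : ((p : ℝ) + l) ≤ (m : ℝ) + l' := by exact_mod_cast (show p + l ≤ m + l' by omega)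
    linarith⟩
  have hq3 : p + l' ≤ j ∧ 2 * ((p : ℝ) + l') < T := ⟨by omega, by
    have : ((p : ℝ) + l') ≤ (m : ℝ) + l' := by exact_mod_cast (show p + l' ≤ m + l' by omega)
    linarith⟩
  have hq5 : m + l ≤ j ∧ 2 * ((m : ℝ) + l) < T := ⟨by omega, by
    have : ((m : ℝ) + l) ≤ (m : ℝ) + l' := by exact_mod_cast (show m + l ≤ m + l' by omega)
    linarith⟩
  have hq7 : m + l' ≤ j ∧ 2 * ((m : ℝ) + l') < T := ⟨by omega, hlow⟩
  have hn2 : ¬ (p + h ≤ j ∧ 2 * ((p : ℝ) + h) < T) := fun hc => by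
    have : ((m : ℝ) + l') ≤ (p : ℝ) + h := by exact_mod_cast hbelow.le
    linarith [hc.2]
  have hn6 : ¬ (m + h ≤ j ∧ 2 * ((m : ℝ) + h) < T) := fun hc => by omega
  have hg1 : ¬ (j + 1 ≤ p + l) := by omega
  have hg2 : ¬ (j + 1 ≤ p + h) := by omega
  have hg3 : ¬ (j + 1 ≤ p + l') := by omega
  have hg5 : ¬ (j + 1 ≤ m + l) := by omega
  have hg6 : j + 1 ≤ m + h := hMG
  have hg7 : ¬ (j + 1 ≤ m + l') := by omega
  have hb1 : p + l ≠ p + h := by omega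
  have hb3 : p + l' ≠ p + h := by omega
  have hb5 : m + l ≠ p + h := by omega
  have hb6 : m + h ≠ p + h := by omega
  have hb7 : m + l' ≠ p + h := by omega
  rw [lightSlice_eq_terms x T₂ γ M₁ M₂ j p m l h l' h (by omega) hhM (by omega) hhM (by omega) hmM]
  refine decAtT_of_oneMid_terms x T j (M₁ + M₂) (p + h) _ _ hx0 hx1 ?_ ?_ ?_ hPj (by omega)
    (by push_cast; intro hc; exact hn2 ⟨hPj, hc⟩) ?_
  · intro i
    fin_cases i <;> first
      | exact mul_nonneg (by linarith) hmE
      | exact mul_nonneg (by linarith) (mul_nonneg hmE hc₁0)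
      | exact mul_nonneg (by linarith) hmC
      | exact mul_nonneg (by linarith) (mul_nonneg hmC hc₂0)
  · have hcc : usage x T₂ j l h - usage x T₂ j l' h ≠ 0 := by linarith
    have h1x' : (1 : ℝ) - x ≠ 0 := h1x.ne'
    simp only [Fin.sum_univ_eight, Matrix.cons_val_zero, Matrix.cons_val_one, Matrix.cons_val]
    field_simp
    ring
  · intro i
    fin_cases i <;> simp <;> omega
  · intro β hβ
    have key := hdual β hβ
    simp only [Fin.sum_univ_eight, Matrix.cons_val_zero, Matrix.cons_val_one, Matrix.cons_val, Nat.cast_add,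
      if_pos hq1, if_neg hn2, if_pos hq3, if_pos hq5, if_neg hn6, if_pos hq7,
      if_neg hg1, if_neg hg2, if_neg hg3, if_neg hg5, if_pos hg6, if_neg hg7,
      if_neg hb1, if_neg hb3, if_neg hb5, if_neg hb6, if_neg hb7,
      if_true, zero_add, add_zero, if_pos hM2c, if_pos hM1c, min_one_ite]
    linarith [key]

/-- light usage `U_ℓ(ρ)` (class-level copy of the notation) -/
local notation3 "UL'[" x ", " ρ "]" => ((x : ℝ) ^ 2 + (1 - x) * ρ) / ((1 - x) * (1 + x - ρ))

set_option maxHeartbeats 4000000 in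
/-- **THE TYPE I LOW-CROSS CLASS IS DEC** (census-1's pattern LLG).  See the module docstring. [this work] -/
theorem lightSlice_decAtT_lowCross_below_typeI (x T₁ T₂ : ℝ) (M₁ M₂ j p m l h l' : ℕ) (hx0 : 0 < x) (hx1 : x < 1)
    (hlow₁ : 2 * (p : ℝ) < T₁) (hmj : m ≤ j) (hmM : m ≤ M₁) (hc₁ : T₁ < (p : ℝ) + m) (hlight₁ : usage x T₁ j p m < x / (1 - x))
    (hd₂ : AtomData x T₂ j M₂ l h l' h) (hll' : l < l')
    (htop : j + 1 ≤ m + h) (hlow : 2 * ((m : ℝ) + l') < T₁ + T₂) (hbelow : p + h ≤ j) :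
    DECAtT x (T₁ + T₂) j (M₁ + M₂) (lconv M₁ M₂ (fun b => TP[p, m, gateOf x T₁ j p m, b]) (atomLaw x T₂ j l h l' h)) := by
  classical
  obtain ⟨hlh, hl'h⟩ := hd₂.lt_of
  obtain ⟨-, a2, a3, a4, a5, -, b2, b3, -, b5, -, c2, c1⟩ := hd₂
  have hpm' : (p : ℝ) < m := by linarith
  have hpm : p < m := by exact_mod_cast hpm'
  have hlh'' : (l' : ℝ) < h := by exact_mod_cast hl'h
  have hlh' : (l : ℝ) < h := by exact_mod_cast hlh
  have hll'r : (l : ℝ) < l' := by exact_mod_cast hll'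
  have h1x : 0 < 1 - x := by linarith
  have hu0 : 0 < x / (1 - x) := div_pos hx0 h1x
  obtain ⟨hγx2, hγ1⟩ := gateOf_bounds x T₁ j p m hx0 hx1 hlow₁ hmj hc₁
  have hγx : gateOf x T₁ j p m < x := gate_lt_of_usage_lt x T₁ j p m hx1 hγ1 hlight₁
  have hγ0 : 0 ≤ gateOf x T₁ j p m := by nlinarith
  have hc₂0 : 0 ≤ usage x T₂ j l' h := (usage_pos_of_compat x T₂ j l' h hx0 hx1 b2 hl'h (Or.inr b5)).le
  -- ### spans and rates (`B′ = h − l′`)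
  have hA0 : (0 : ℝ) < (m : ℝ) - p := by linarith
  have hB0 : (0 : ℝ) < (h : ℝ) - l' := by linarith
  have hE0 : (0 : ℝ) < (h : ℝ) - l := by linarith
  obtain ⟨r, hr⟩ : ∃ r : ℝ, r = (T₁ - 2 * (p : ℝ)) / ((m : ℝ) - p) := ⟨_, rfl⟩
  obtain ⟨ρc, hρc⟩ : ∃ ρc : ℝ, ρc = (T₂ - 2 * (l' : ℝ)) / ((h : ℝ) - l') := ⟨_, rfl⟩
  obtain ⟨a, ha⟩ : ∃ a : ℝ, a = ((m : ℝ) - p) / ((h : ℝ) - l') := ⟨_, rfl⟩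
  obtain ⟨ρe, hρe⟩ : ∃ ρe : ℝ, ρe = (T₂ - 2 * (l : ℝ)) / ((h : ℝ) - l) := ⟨_, rfl⟩
  obtain ⟨ε, hε⟩ : ∃ ε : ℝ, ε = ((h : ℝ) - l) / ((h : ℝ) - l') := ⟨_, rfl⟩
  have hrA : r * ((m : ℝ) - p) = T₁ - 2 * (p : ℝ) := by rw [hr]; field_simp
  have hρB : ρc * ((h : ℝ) - l') = T₂ - 2 * (l' : ℝ) := by rw [hρc]; field_simp
  have haB : a * ((h : ℝ) - l') = (m : ℝ) - p := by rw [ha]; field_simp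
  have hρeE : ρe * ((h : ℝ) - l) = T₂ - 2 * (l : ℝ) := by rw [hρe]; field_simp
  have hεB : ε * ((h : ℝ) - l') = (h : ℝ) - l := by rw [hε]; field_simp
  have hr0 : 0 ≤ r := by rw [hr]; exact div_nonneg (by linarith) hA0.le
  have hrx : r < x := rate_lt_of_usage_lt x T₁ j p m r hx1 hmj hA0 hrA hγ1 hlight₁
  obtain ⟨-, hg2'⟩ := gateOf_bounds x T₂ j l' h hx0 hx1 b2 b3 b5
  have hρcx : ρc < x := rate_lt_of_usage_lt x T₂ j l' h ρc hx1 b3 hB0 hρB hg2' c2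
  have ha0 : 0 < a := by rw [ha]; exact div_pos hA0 hB0
  have hε0 : 0 < ε := by rw [hε]; exact div_pos hE0 hB0
  have hraB : r * (a * ((h : ℝ) - l')) = r * ((m : ℝ) - p) := by rw [haB]
  have hlc : (2 - r) * a < ρc := by
    have key : ((2 - r) * a) * ((h : ℝ) - l') < ρc * ((h : ℝ) - l') := by linarith [hraB, hrA, hρB, haB]
    exact lt_of_mul_lt_mul_right key hB0.le
  have ha1 : a < 1 := by nlinarith
  have h1a : 0 < 1 - a := by linarith
  have hρe1 : ρe < 1 := by
    have : ρe * ((h : ℝ) - l) < 1 * ((h : ℝ) - l) := by rw [hρeE]; linarith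
    exact lt_of_mul_lt_mul_right this hE0.le
  have hρex : x < ρe := by
    by_contra hle
    push Not at hle
    obtain ⟨-, hg1e⟩ := gateOf_bounds x T₂ j l h hx0 hx1 a2 a3 a5
    have hUl := usage_eq_Ul x T₂ j l h ρe hx0 hx1 a3 a2 a5 hρeE hle
    have : usage x T₂ j l h ≤ x / (1 - x) := by rw [hUl]; exact CrossGiantCell.Ul_le_u x ρe hx0 hx1 hle
    linarith
  -- Type I: `2 - ρc = ε (2 - ρe)` (both are `(2h − T₂)/B′`)
  have hdI : 2 - ρc ≤ ε * (2 - ρe) := by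
    have e1 : (2 - ρc) * ((h : ℝ) - l') = 2 * (h : ℝ) - T₂ := by linarith [hρB]
    have e2 : ε * (2 - ρe) * ((h : ℝ) - l') = 2 * (h : ℝ) - T₂ := by
      have : ε * (2 - ρe) * ((h : ℝ) - l') = (2 - ρe) * (ε * ((h : ℝ) - l')) := by ring
      rw [this, hεB]; linarith [hρeE]
    have : (2 - ρc) * ((h : ℝ) - l') ≤ ε * (2 - ρe) * ((h : ℝ) - l') := by rw [e1, e2]
    exact le_of_mul_le_mul_right this hB0
  -- ### the gate and the atom's rates in closed form
  have hγ : gateOf x T₁ j p m = x ^ 2 + (1 - x) * r := by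
    rw [gateOf_of_le x T₁ j p m hmj, pairGate_eq_light x T₁ p m hx0.le (by rw [← hr]; exact hrx.le), ← hr]
  have hc₂v : usage x T₂ j l' h = UL'[x, ρc] := usage_eq_Ul x T₂ j l' h ρc hx0 hx1 b3 b2 b5 hρB hρcx.le
  have hc₁v : usage x T₂ j l h = ρe / (1 - ρe) := usage_eq_Uh x T₂ j l h ρe hx0 hx1 a3 a2 a5 hρeE hρex.le
  -- ### the cross pairs P2 = p + l', M2 = m + l' into the mid p + h
  obtain ⟨P, hP⟩ : ∃ P : ℝ, P = ρc + r * a := ⟨_, rfl⟩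
  obtain ⟨M, hM⟩ : ∃ M : ℝ, M = (ρc + r * a - 2 * a) / (1 - a) := ⟨_, rfl⟩
  have hPB : P * ((h : ℝ) - l') = (T₁ + T₂) - 2 * ((p : ℝ) + l') := by rw [hP]; linarith [hraB, hrA, hρB]
  have hMB : M * ((1 - a) * ((h : ℝ) - l')) = (T₁ + T₂) - 2 * ((m : ℝ) + l') := by
    have e : M * ((1 - a) * ((h : ℝ) - l')) = (ρc + r * a - 2 * a) * ((h : ℝ) - l') := by rw [hM]; field_simp
    rw [e]; linarith [hPB, haB, hP]
  have hPspan : P * ((((p + h : ℕ) : ℝ)) - ((p + l' : ℕ) : ℝ)) = (T₁ + T₂) - 2 * (((p + l' : ℕ) : ℝ)) := by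
    push_cast
    have e : ((p : ℝ) + h - ((p : ℝ) + l')) = (h : ℝ) - l' := by ring
    rw [e, hPB]
  have hMspan : M * ((((p + h : ℕ) : ℝ)) - ((m + l' : ℕ) : ℝ)) = (T₁ + T₂) - 2 * (((m + l' : ℕ) : ℝ)) := by
    push_cast
    have e : ((p : ℝ) + h - ((m : ℝ) + l')) = (1 - a) * ((h : ℝ) - l') := by linarith [haB]
    rw [e, hMB]
  have hMx : M < x := by
    rw [hM, div_lt_iff₀ h1a]
    have : ρc + r * a - x < r * a := by linarith
    nlinarith [mul_pos ha0 h1x]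
  have hcompM : T₁ + T₂ < ((m + l' : ℕ) : ℝ) + ((p + h : ℕ) : ℝ) := by
    have hdM : (0 : ℝ) < ((p + h : ℕ) : ℝ) - ((m + l' : ℕ) : ℝ) := by push_cast; nlinarith
    have h1 : M * ((((p + h : ℕ) : ℝ)) - ((m + l' : ℕ) : ℝ)) < 1 * ((((p + h : ℕ) : ℝ)) - ((m + l' : ℕ) : ℝ)) :=
      mul_lt_mul_of_pos_right (by linarith) hdM
    rw [hMspan] at h1; linarith
  have hlowM : 2 * (((m + l' : ℕ) : ℝ)) < T₁ + T₂ := by push_cast; exact hlow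
  have hM2 : usage x (T₁ + T₂) j (m + l') (p + h) = UL'[x, M] :=
    usage_eq_Ul x (T₁ + T₂) j (m + l') (p + h) M hx0 hx1 hbelow hlowM hcompM hMspan hMx.le
  have hM2compat : T₁ + T₂ < ((m : ℝ) + l') + ((p : ℝ) + h) := by push_cast at hcompM; linarith
  have hbelow' : m + l' < p + h := by
    have : ((m : ℝ) + l') < (p : ℝ) + h := by linarith
    exact_mod_cast this
  have hcP2 : (T₁ + T₂ < ((p : ℝ) + l') + ((p : ℝ) + h)) ↔ P < 1 := by
    constructor
    · intro hc
      have : P * ((h : ℝ) - l') < 1 * ((h : ℝ) - l') := by rw [hPB]; linarith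
      exact lt_of_mul_lt_mul_right this hB0.le
    · intro hP1
      have : P * ((h : ℝ) - l') < 1 * ((h : ℝ) - l') := mul_lt_mul_of_pos_right hP1 hB0
      rw [hPB] at this; linarith
  have hlowP : 2 * (((p + l' : ℕ) : ℝ)) < T₁ + T₂ := by push_cast; linarith
  have hUP2l : P ≤ x → usage x (T₁ + T₂) j (p + l') (p + h) = UL'[x, P] := by
    intro hPx
    have hc : T₁ + T₂ < ((p : ℝ) + l') + ((p : ℝ) + h) := hcP2.2 (by linarith)
    have hcompP : T₁ + T₂ < ((p + l' : ℕ) : ℝ) + ((p + h : ℕ) : ℝ) := by push_cast; exact hc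
    exact usage_eq_Ul x (T₁ + T₂) j (p + l') (p + h) P hx0 hx1 hbelow hlowP hcompP hPspan hPx
  have hUP2h : x ≤ P → P < 1 → usage x (T₁ + T₂) j (p + l') (p + h) = P / (1 - P) := by
    intro hPx hP1
    have hc : T₁ + T₂ < ((p : ℝ) + l') + ((p : ℝ) + h) := hcP2.2 hP1
    have hcompP : T₁ + T₂ < ((p + l' : ℕ) : ℝ) + ((p + h : ℕ) : ℝ) := by push_cast; exact hc
    exact usage_eq_Uh x (T₁ + T₂) j (p + l') (p + h) P hx0 hx1 hbelow hlowP hcompP hPspan hPx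
  -- ### the pairs P1 = p + l, M1 = m + l into the same mid p + h
  obtain ⟨ρS, hρS⟩ : ∃ ρS : ℝ, ρS = ρe + r * a / ε := ⟨_, rfl⟩
  obtain ⟨ρN, hρN⟩ : ∃ ρN : ℝ, ρN = ρe - a * (2 - ρe - r) / (ε - a) := ⟨_, rfl⟩
  have haE : a / ε * ((h : ℝ) - l) = (m : ℝ) - p := by
    rw [← hεB, ← haB]; field_simp
  have hSE : ρS * ((h : ℝ) - l) = (T₁ + T₂) - 2 * ((p : ℝ) + l) := by
    rw [hρS]
    have : (ρe + r * a / ε) * ((h : ℝ) - l) = ρe * ((h : ℝ) - l) + r * (a / ε * ((h : ℝ) - l)) := by ring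
    rw [this, hρeE, haE, hrA]; ring
  have hSspan : ρS * ((((p + h : ℕ) : ℝ)) - ((p + l : ℕ) : ℝ)) = (T₁ + T₂) - 2 * (((p + l : ℕ) : ℝ)) := by
    push_cast
    have e : ((p : ℝ) + h - ((p : ℝ) + l)) = (h : ℝ) - l := by ring
    rw [e, hSE]
  have hεa : a < ε := by
    rw [ha, hε, div_lt_div_iff_of_pos_right hB0]
    have h1 : ((m : ℝ) + l') < (p : ℝ) + h := by exact_mod_cast hbelow'
    linarith
  have hεa' : 0 < ε - a := by linarith
  have hNspanE : ρN * ((ε - a) * ((h : ℝ) - l')) = (T₁ + T₂) - 2 * ((m : ℝ) + l) := by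
    rw [hρN]
    have e : (ρe - a * (2 - ρe - r) / (ε - a)) * ((ε - a) * ((h : ℝ) - l'))
        = ρe * (ε * ((h : ℝ) - l')) - 2 * (a * ((h : ℝ) - l')) + r * (a * ((h : ℝ) - l')) := by
      field_simp
      ring
    rw [e, hεB, hρeE, haB, hrA]; ring
  have hspanN : (((p + h : ℕ) : ℝ)) - ((m + l : ℕ) : ℝ) = (ε - a) * ((h : ℝ) - l') := by
    push_cast
    have : (ε - a) * ((h : ℝ) - l') = ε * ((h : ℝ) - l') - a * ((h : ℝ) - l') := by ring
    rw [this, hεB, haB]; ring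
  have hNspan : ρN * ((((p + h : ℕ) : ℝ)) - ((m + l : ℕ) : ℝ)) = (T₁ + T₂) - 2 * (((m + l : ℕ) : ℝ)) := by
    rw [hspanN, hNspanE]; push_cast; ring
  have hρNe : ρN ≤ ρe := by
    rw [hρN]; linarith [div_nonneg (mul_nonneg ha0.le (by linarith : (0:ℝ) ≤ 2 - ρe - r)) hεa'.le]
  have hdN : (0 : ℝ) < ((p + h : ℕ) : ℝ) - ((m + l : ℕ) : ℝ) := by rw [hspanN]; positivity
  have hlowN : 2 * (((m + l : ℕ) : ℝ)) < T₁ + T₂ := by push_cast; linarith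
  have hM1c : T₁ + T₂ < ((m : ℝ) + l) + ((p : ℝ) + h) := by
    have h1 : ρN * ((((p + h : ℕ) : ℝ)) - ((m + l : ℕ) : ℝ)) < 1 * ((((p + h : ℕ) : ℝ)) - ((m + l : ℕ) : ℝ)) :=
      mul_lt_mul_of_pos_right (by linarith) hdN
    rw [hNspan] at h1; push_cast at h1; linarith
  have hcompN : T₁ + T₂ < ((m + l : ℕ) : ℝ) + ((p + h : ℕ) : ℝ) := by push_cast; linarith
  have hUM1l : ρN ≤ x → usage x (T₁ + T₂) j (m + l) (p + h) = UL'[x, ρN] := fun hNx =>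
    usage_eq_Ul x (T₁ + T₂) j (m + l) (p + h) ρN hx0 hx1 hbelow hlowN hcompN hNspan hNx
  have hUM1h : x ≤ ρN → usage x (T₁ + T₂) j (m + l) (p + h) = ρN / (1 - ρN) := fun hNx =>
    usage_eq_Uh x (T₁ + T₂) j (m + l) (p + h) ρN hx0 hx1 hbelow hlowN hcompN hNspan hNx
  have hlowS : 2 * (((p + l : ℕ) : ℝ)) < T₁ + T₂ := by push_cast; linarith
  have hcP1 : (T₁ + T₂ < ((p : ℝ) + l) + ((p : ℝ) + h)) ↔ ρS < 1 := by
    constructor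
    · intro hc
      have : ρS * ((h : ℝ) - l) < 1 * ((h : ℝ) - l) := by rw [hSE]; linarith
      exact lt_of_mul_lt_mul_right this hE0.le
    · intro hS1
      have : ρS * ((h : ℝ) - l) < 1 * ((h : ℝ) - l) := mul_lt_mul_of_pos_right hS1 hE0
      rw [hSE] at this; linarith
  have hρSx : x ≤ ρS := by rw [hρS]; linarith [div_nonneg (mul_nonneg hr0 ha0.le) hε0.le]
  have hUP1 : ρS < 1 → usage x (T₁ + T₂) j (p + l) (p + h) = ρS / (1 - ρS) := by
    intro hS1
    have hc : T₁ + T₂ < ((p : ℝ) + l) + ((p : ℝ) + h) := hcP1.2 hS1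
    have hcompS : T₁ + T₂ < ((p + l : ℕ) : ℝ) + ((p + h : ℕ) : ℝ) := by push_cast; exact hc
    exact usage_eq_Uh x (T₁ + T₂) j (p + l) (p + h) ρS hx0 hx1 hbelow hlowS hcompS hSspan hρSx
  -- ### masses and the balance identity
  have hK : 0 < (1 - x) / (usage x T₂ j l h - usage x T₂ j l' h) := div_pos h1x (by linarith [c2.trans c1])
  obtain ⟨mE, hmEdef⟩ : ∃ mE : ℝ, mE = (1 - x) / (usage x T₂ j l h - usage x T₂ j l' h) * (x / (1 - x) - usage x T₂ j l' h) := ⟨_, rfl⟩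
  obtain ⟨mC, hmCdef⟩ : ∃ mC : ℝ, mC = (1 - x) / (usage x T₂ j l h - usage x T₂ j l' h) * (usage x T₂ j l h - x / (1 - x)) := ⟨_, rfl⟩
  have hmE : 0 ≤ mE := by rw [hmEdef]; exact mul_nonneg hK.le (by linarith [c2])
  have hmC : 0 < mC := by rw [hmCdef]; exact mul_pos hK (by linarith [c1])
  have hbal : mE * (usage x T₂ j l h - x / (1 - x)) = mC * (x / (1 - x) - usage x T₂ j l' h) := by
    rw [hmEdef, hmCdef]; ring
  -- ### apply the one-mid form with the cell inequality (both prices equal)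
  refine lightSlice_decAtT_typeI_of_oneMid x (T₁ + T₂) T₂ (gateOf x T₁ j p m) M₁ M₂ j p m l h l' hx0 hx1 hγ0 hγ1.le
    hc₂0 c2 c1 hpm hll' hl'h hmM a4 hlow hbelow' hbelow htop hM2compat hM1c ?_
  intro β hβ
  rw [← hmEdef, ← hmCdef, hγ]
  have key := TwoMidCell.main x r ρc a ρe ε mE mC (usage x T₂ j l h) (usage x T₂ j l' h)
    (usage x (T₁ + T₂) j (p + l) (p + h)) (usage x (T₁ + T₂) j (m + l) (p + h))
    (usage x (T₁ + T₂) j (p + l') (p + h)) (usage x (T₁ + T₂) j (m + l') (p + h)) β β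
    (T₁ + T₂ < ((p : ℝ) + l) + ((p : ℝ) + h)) (T₁ + T₂ < ((p : ℝ) + l') + ((p : ℝ) + h))
    hx0 hx1 hr0 hrx hρcx ha0 ha1 hlc hρex hρe1 hdI hmC hmE hbal hc₁v hc₂v
    (by rw [← hP]; exact hcP2) (by rw [← hP]; exact hUP2l) (by rw [← hP]; exact hUP2h) (by rw [← hM]; exact hM2)
    (by rw [← hρS]; exact hcP1) (by rw [← hρS]; exact hUP1) (by rw [← hρN]; exact hUM1l) (by rw [← hρN]; exact hUM1h)
    hβ hβ
  linarith [key]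

/-- **`LightSliceLowCrossBelow` HOLDS** (census-2 g59's residue conjecture, p333141): Type I by `lightSlice_decAtT_lowCross_below_typeI`,
crossed Type II by `lightSlice_decAtT_lowCross_below_crossed`. [this work] -/
theorem lightSliceLowCrossBelow_holds : LightSliceLowCrossBelow := by
  intro x T₁ T₂ M₁ M₂ j l₁ h₁ l₁' h₁' l₂ h₂ l₂' h₂' hx0 hx1 hj hd₁ hd₂ ho₁ ho₂ ho₃ ho₄ hw₁ hw₂ hb₁ hb₂ hdeep₁ hdeep₂ hA2 htie htop hlow
    hbelow
  obtain ⟨-, -, -, -, -, -, b2, b3, b4, b5, -, c2, -⟩ := hd₁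
  rcases (ho₄ : h₂' ≤ h₂).eq_or_lt with heq | hlt
  · subst heq
    exact lightSlice_decAtT_lowCross_below_typeI x T₁ T₂ M₁ M₂ j l₁' h₁' l₂ h₂' l₂' hx0 hx1 b2 b3 b4 b5 c2 hd₂ ho₃ htop hlow hbelow
  · exact lightSlice_decAtT_lowCross_below_crossed x T₁ T₂ M₁ M₂ j l₁' h₁' l₂ h₂ l₂' h₂' hx0 hx1 b2 b3 b4 b5 c2 hd₂ ho₃ hlt hA2 htop
      hlow hbelow

/-- **`LightSliceLowCross` HOLDS.** [this work] -/
theorem lightSliceLowCross_holds : LightSliceLowCross := lightSliceLowCross_of_below lightSliceLowCrossBelow_holds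

/-- **`LightSliceCore ⟸ LightSliceWide`.** [this work] -/
theorem lightSliceCore_of_wide (hW : LightSliceWide) : LightSliceCore := lightSliceCore_of_below lightSliceLowCrossBelow_holds hW

/-- **`ConvClosedT ⟸ LightSliceWide`.** [this work] -/
theorem convClosedT_of_wide (hW : LightSliceWide) : ConvClosedT := convClosedT_of_below lightSliceLowCrossBelow_holds hW

end LawDec

/-- **`Quant.FarTreeRow ⟸ LightSliceWide ∧ GatedConvEmptyFree`.**  CONDITIONAL: both hypotheses are `@[conjecture]` (`LightSliceWide` is a
theorem at the floors `1 ≤ x³+x²+3x`, arm-2's `lightSliceWide_of_sharpFloor`). [this work] -/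
theorem farTreeRow_of_wide (hW : LawDec.LightSliceWide) (hIII : LawDec.GatedConvEmptyFree) : FarTreeRow :=
  farTreeRow_of_below LawDec.lightSliceLowCrossBelow_holds hW hIII

/-- **`Quant.FarTreeRow ⟸ LightSliceWide ∧ GateMove`.**  CONDITIONAL. [this work] -/
theorem farTreeRow_of_wide_gateMove (hW : LawDec.LightSliceWide) (hG : LawDec.GateMove) : FarTreeRow :=
  farTreeRow_of_below_gateMove LawDec.lightSliceLowCrossBelow_holds hW hG

end Quant

end Summit.CriticalPhenomena.PercolationContinuityZ3.Theorems
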